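import Mathlib
import HarnessLib
import Summits.Langlands.Langlands.Theses.TriangulineChamber
import Literature.NumberTheory.GaloisRepresentations.PadicAlgebraOfLocalField
import Literature.RingTheory.DiscreteValuationRing.AdicCompletionResidueField
import Literature.NumberTheory.PAdicHodge.FontaineDpst

/-!
# `LiftB2CrysSplitP` (item stmt-Langlands-8575) — "`p` splits completely ⇒ `F_v = ℚ_p`"

The hypothesis of the split-completely slice `LiftB2CrysSplitP` of route `TriangulineChamber`,

  `∀ v ∣ p, v.residueCard = p ∧ ¬ v.asIdeal ^ 2 ∣ (p)`   (residue degree `f_v = 1`, ramification `e_v = 1`),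

is the arithmetic way of saying that EVERY completion `F_v`, `v ∣ p`, IS `ℚ_p`: the canonical
embedding `ℚ_p → F_v` (tree: `LocalField.padicRingHom`, `LocalField.adicCompletionPadicAlgebra`,
the `ℚ_p`-structure carried by the pinned datum `RD.pst p v hv` under `FontaineDatumExists`) is
a BIJECTION.  This is the reduction step that puts the slice in Kisin's setting `G_{F_v} = G_{ℚ_p}`
(Kisin 2009; the item's informal text "every `F_v = ℚ_p`"), and it makes the item's quantifier
`∀ τ : F_v →ₐ[ℚ_p] ℚ̄_p` range over exactly ONE embedding.

Contents (helpers `--supports stmt-Langlands-8575`; nothing here closes the item):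

* `padicRingHom_surjective_of_uniformizer_of_residue` — for a characteristic-`0` non-archimedean
  local field `K` of residue characteristic `p` in which `p` is a uniformiser (`|x| < 1 ⇒ |x| ≤ |p|`)
  and whose residue field is the prime field (every integer of `K` is congruent to a rational
  integer modulo the maximal ideal), the canonical `ℚ_p → K` is surjective (Serre, *Local Fields*
  II §4–5: `p`-adic expansions with digits in `{0, …, p-1}`; the image of `ℤ_p` is compact, hence
  closed, and contains the dense subset `ℤ` of `𝒪_K`).
* `valued_natCast_eq_exp_neg_one`, `valuation_le_valuation_natCast_of_lt_one`,
  `exists_int_valuation_sub_lt_one` — the two hypotheses for `K = F_v` from `e_v = 1`, `f_v = 1`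
  (Mathlib `intValuation_le_pow_iff_dvd`; tree `exists_sub_algebraMap_mem_maximalIdeal`,
  `residueCard = absNorm v`, a group of prime order is generated by `1`).
* `algebraMap_adicCompletion_surjective_of_split`, `…_bijective_of_split`,
  `finrank_adicCompletion_eq_one_of_split`, `algHom_adicCompletion_subsingleton_of_split` —
  `ℚ_p ≅ F_v`, `[F_v : ℚ_p] = 1`, uniqueness of `ℚ_p`-embeddings of `F_v`.
* `splitP_pst_algebraMap_bijective` — the same for the `ℚ_p`-structure `D.algebra` of the item's
  datum `D = RD.pst p v hv` (which is the canonical one under `FontaineDatumExists`, clause (F1)),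
  for every `RD`, together with existence and uniqueness of the embedding `τ`.

Axioms: `propext`, `Classical.choice`, `Quot.sound`.  No `sorry`, no new definitions.
-/

-- project-wide option (lakefile weak.linter.dupNamespace); `Summit.Langlands.Langlands` is mandated
set_option linter.dupNamespace false

noncomputable section

namespace Summit.Langlands.Langlands.Theorems.LiftB2CrysSplitP

open Summit.Langlands.Langlands.Theses.TriangulineChamber
open NumberField IsDedekindDomain ValuativeRel WithZero
open Literature.NumberTheory.GaloisRepresentations

/-! ### A local field with `e = f = 1` over `ℚ_p` is `ℚ_p` -/

section LocalField

variable {K : Type*} [Field K] [ValuativeRel K] [TopologicalSpace K] [IsNonarchimedeanLocalField K]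

/-- A field with a valuative topology is Hausdorff: a non-zero `x` is separated from `0` by the
open ball `{y | |y| < |x|}`. [folklore] -/
theorem t2Space_of_isValuativeTopology : T2Space K := by
  apply IsTopologicalAddGroup.t2Space_of_zero_sep
  intro x hx
  have hx' : valuation K x ≠ 0 := by rwa [ne_eq, map_eq_zero]
  refine ⟨{y | valuation K y < valuation K x}, ?_,
    fun (h : valuation K x < valuation K x) => lt_irrefl _ h⟩
  exact (IsValuativeTopology.hasBasis_nhds_zero K).mem_of_mem (i := Units.mk0 _ hx') trivial

variable [CharZero K] {p : ℕ} [Fact p.Prime]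

omit [TopologicalSpace K] [IsNonarchimedeanLocalField K] in
/-- **`p`-adic digits.** If `p` is a uniformiser of `K` (`|x| < 1 ⇒ |x| ≤ |p|`) and every
integer of `K` is congruent to a rational integer modulo the maximal ideal, then every integer
`x` of `K` is congruent to a rational integer modulo `pⁿ`, for every `n` (induction on `n`:
Serre, *Local Fields* II §4, Prop. 8). [folklore] -/
theorem exists_int_valuation_sub_le_pow
    (he : ∀ x : K, valuation K x < 1 → valuation K x ≤ valuation K p)
    (hf : ∀ y : K, valuation K y ≤ 1 → ∃ b : ℤ, valuation K (y - b) < 1)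
    {x : K} (hx : valuation K x ≤ 1) (n : ℕ) :
    ∃ a : ℤ, valuation K (x - a) ≤ valuation K p ^ n := by
  induction n with
  | zero => exact ⟨0, by simpa using hx⟩
  | succ n ih =>
    obtain ⟨a, ha⟩ := ih
    have hp0 : (p : K) ≠ 0 := Nat.cast_ne_zero.2 (Fact.out : p.Prime).ne_zero
    have hvp0 : valuation K p ≠ 0 := by rwa [ne_eq, map_eq_zero]
    set w : K := (x - a) / (p : K) ^ n with hw
    have hwx : w * (p : K) ^ n = x - a := div_mul_cancel₀ _ (pow_ne_zero n hp0)
    have hw1 : valuation K w ≤ 1 := by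
      rw [hw, map_div₀, map_pow, div_le_one₀ (pow_pos (zero_lt_iff.2 hvp0) n)]
      exact ha
    obtain ⟨b, hb⟩ := hf w hw1
    have hb' : valuation K (w - b) ≤ valuation K p := he _ hb
    refine ⟨a + b * p ^ n, ?_⟩
    have hxw : x - ((a + b * p ^ n : ℤ) : K) = (w - b) * (p : K) ^ n := by
      push_cast
      rw [sub_mul, hwx]
      ring
    rw [hxw, map_mul, map_pow, pow_succ']
    exact mul_le_mul' hb' le_rfl

/-- **A `p`-adic local field with `e = f = 1` is `ℚ_p`.** Let `K` be a characteristic-`0`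
non-archimedean local field of residue characteristic `p` (`|p| < 1`) in which `p` is a
uniformiser (`|x| < 1 ⇒ |x| ≤ |p|`, i.e. `e(K/ℚ_p) = 1`) and whose residue field is the prime field
(every integer is congruent to a rational integer modulo the maximal ideal, i.e. `f(K/ℚ_p) = 1`).
Then the canonical embedding `ℚ_p → K` (tree `LocalField.padicRingHom`) is surjective: the image
of `ℤ_p` is compact, hence closed, and by `exists_int_valuation_sub_le_pow` it is dense in the
valuation ring; scaling by powers of `p` gives all of `K` (Serre, *Local Fields* II §4–§5;
Neukirch, ANT II (5.2): `[K : ℚ_p] = e f`). [folklore] -/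
theorem padicRingHom_surjective_of_uniformizer_of_residue (hp : valuation K p < 1)
    (he : ∀ x : K, valuation K x < 1 → valuation K x ≤ valuation K p)
    (hf : ∀ y : K, valuation K y ≤ 1 → ∃ b : ℤ, valuation K (y - b) < 1) :
    Function.Surjective (LocalField.padicRingHom K p hp) := by
  haveI : T2Space K := t2Space_of_isValuativeTopology
  set φ := LocalField.padicRingHom K p hp with hφ
  have hp0 : (p : K) ≠ 0 := Nat.cast_ne_zero.2 (Fact.out : p.Prime).ne_zero
  -- the compact, hence closed, image of `ℤ_p`
  set C : Set K := Set.range (fun z : ℤ_[p] => φ (z : ℚ_[p])) with hC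
  have hCc : IsClosed C := by
    have hcoe : Continuous ((↑) : ℤ_[p] → ℚ_[p]) := continuous_subtype_val
    have hc : Continuous (fun z : ℤ_[p] => φ (z : ℚ_[p])) :=
      (LocalField.continuous_padicRingHom K p hp).comp hcoe
    haveI : CompactSpace ℤ_[p] := PadicInt.compactSpace p
    exact (@isCompact_range _ _ _ _ this _ hc).isClosed
  -- the integers of `K` lie in `C`
  have hint : ∀ x : K, valuation K x ≤ 1 → x ∈ C := by
    intro x hx
    rw [← hCc.closure_eq, mem_closure_iff_nhds_basis (IsValuativeTopology.hasBasis_nhds x)]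
    intro γ _
    obtain ⟨n, hn⟩ := exists_pow_lt₀ hp γ
    obtain ⟨a, ha⟩ := exists_int_valuation_sub_le_pow he hf hx n
    refine ⟨φ (a : ℚ_[p]), ⟨(a : ℤ_[p]), by simp⟩, ?_⟩
    rw [Set.mem_setOf_eq, map_intCast, Valuation.map_sub_swap]
    exact ha.trans_lt hn
  intro x
  by_cases hx0 : x = 0
  · exact ⟨0, by simp [hx0]⟩
  -- scale `x` into the integers
  have hvx0 : valuation K x ≠ 0 := by rwa [ne_eq, map_eq_zero]
  obtain ⟨N, hN⟩ := exists_pow_lt₀ hp (Units.mk0 (valuation K x)⁻¹ (inv_ne_zero hvx0))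
  have hN' : valuation K ((p : K) ^ N * x) ≤ 1 := by
    rw [map_mul, map_pow]
    calc valuation K p ^ N * valuation K x
        ≤ (valuation K x)⁻¹ * valuation K x := mul_le_mul' hN.le le_rfl
      _ = 1 := inv_mul_cancel₀ hvx0
  obtain ⟨z, hz⟩ := hint _ hN'
  change φ (z : ℚ_[p]) = (p : K) ^ N * x at hz
  refine ⟨(z : ℚ_[p]) / (p : ℚ_[p]) ^ N, ?_⟩
  rw [map_div₀, map_pow, map_natCast, hz]
  field_simp

end LocalField

/-! ### The completion `K_v` at a place with `e_v = f_v = 1` -/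

section AdicCompletion

variable {K : Type*} [Field K] [NumberField K] (v : HeightOneSpectrum (𝓞 K)) (p : ℕ)
  [Fact p.Prime]

/-- `|p|_v = exp (-1)` in `K_v` when `v ∣ p` is unramified over `p` (`v ∣ (p)`, `v² ∤ (p)`: the
exponent of `v` in `(p)` is `1`; Mathlib `intValuation_le_pow_iff_dvd`). [folklore] -/
theorem valued_natCast_eq_exp_neg_one (hv : ((p : ℕ) : 𝓞 K) ∈ v.asIdeal)
    (he : ¬ v.asIdeal ^ 2 ∣ Ideal.span {((p : ℕ) : 𝓞 K)}) :
    Valued.v (p : v.adicCompletion K) = exp (-1 : ℤ) := by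
  have h1 : (p : v.adicCompletion K) = ((algebraMap (𝓞 K) K p : K) : v.adicCompletion K) := by
    rw [← map_natCast (algebraMap (𝓞 K) (v.adicCompletion K)) p]
    rfl
  rw [h1, HeightOneSpectrum.adicCompletion.valued_coe, HeightOneSpectrum.valuation_of_algebraMap]
  have hle : v.intValuation (p : 𝓞 K) ≤ exp (-((1 : ℕ) : ℤ)) := by
    rw [HeightOneSpectrum.intValuation_le_pow_iff_dvd, pow_one, Ideal.dvd_span_singleton]
    exact hv
  have hnle : ¬ v.intValuation (p : 𝓞 K) ≤ exp (-((2 : ℕ) : ℤ)) := by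
    rw [HeightOneSpectrum.intValuation_le_pow_iff_dvd]
    exact he
  have h0 : v.intValuation (p : 𝓞 K) ≠ 0 :=
    v.intValuation_ne_zero _ (by exact_mod_cast (Fact.out : p.Prime).ne_zero)
  rw [← exp_log h0] at hle hnle ⊢
  rw [exp_le_exp] at hle hnle
  rw [exp_inj]
  push_cast at hle hnle
  omega

/-- `e_v = 1` in valuative terms: in `K_v`, `|x| < 1 ⇒ |x| ≤ |p|` (`p` is a uniformiser of
`K_v`), for the valuation of the valuative relation of `K_v` (tree instance
`instValuativeRelAdicCompletion`, equivalent to Mathlib's `Valued.v`). [folklore] -/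
theorem valuation_le_valuation_natCast_of_lt_one (hv : ((p : ℕ) : 𝓞 K) ∈ v.asIdeal)
    (he : ¬ v.asIdeal ^ 2 ∣ Ideal.span {((p : ℕ) : 𝓞 K)}) (x : v.adicCompletion K)
    (hx : valuation (v.adicCompletion K) x < 1) :
    valuation (v.adicCompletion K) x ≤ valuation (v.adicCompletion K) (p : v.adicCompletion K) := by
  have hequiv := ValuativeRel.isEquiv (valuation (v.adicCompletion K))
    (Valued.v : Valuation (v.adicCompletion K) ℤᵐ⁰)
  rw [hequiv x (p : v.adicCompletion K), valued_natCast_eq_exp_neg_one v p hv he,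
    ← lt_mul_exp_iff_le exp_ne_zero, ← exp_add]
  norm_num
  exact hequiv.lt_one_iff_lt_one.1 hx

/-- `f_v = 1` in valuative terms: if `N v = p` then every integer of `K_v` is congruent to a
rational integer modulo the maximal ideal (`𝒪_v/𝔪_v = 𝓞 K / v` by the tree's
`exists_sub_algebraMap_mem_maximalIdeal`, and `𝓞 K / v`, of prime order `p`, is generated by `1`
as an additive group). [folklore] -/
theorem exists_int_valuation_sub_lt_one (hf : v.residueCard = p) (y : v.adicCompletion K)
    (hy : valuation (v.adicCompletion K) y ≤ 1) :
    ∃ b : ℤ, valuation (v.adicCompletion K) (y - b) < 1 := by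
  have hequiv := ValuativeRel.isEquiv (valuation (v.adicCompletion K))
    (Valued.v : Valuation (v.adicCompletion K) ℤᵐ⁰)
  have hy' : Valued.v y ≤ 1 := hequiv.le_one_iff_le_one.1 hy
  set y₀ : v.adicCompletionIntegers K := ⟨y, hy'⟩ with hy₀
  obtain ⟨c, hc⟩ := HeightOneSpectrum.exists_sub_algebraMap_mem_maximalIdeal K v y₀
  -- `c ≡ n (mod v)` for a rational integer `n`
  have hcard : Nat.card (𝓞 K ⧸ v.asIdeal) = p := by
    rw [← Submodule.cardQuot_apply, ← Ideal.absNorm_apply]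
    exact hf
  have h1 : (1 : 𝓞 K ⧸ v.asIdeal) ≠ 0 := fun h =>
    v.isPrime.ne_top (Ideal.Quotient.zero_eq_one_iff.1 h.symm)
  have htop := zmultiples_eq_top_of_prime_card hcard h1
  obtain ⟨n, hn⟩ := (AddSubgroup.mem_zmultiples_iff).1
    (htop ▸ AddSubgroup.mem_top (Ideal.Quotient.mk v.asIdeal c))
  have hcn : c - n ∈ v.asIdeal := by
    rw [← Ideal.Quotient.eq_zero_iff_mem, map_sub, map_intCast, ← zsmul_one, hn, sub_self]
  refine ⟨n, hequiv.lt_one_iff_lt_one.2 ?_⟩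
  have hmem : y₀ - algebraMap (𝓞 K) _ (n : 𝓞 K) ∈
      IsLocalRing.maximalIdeal (v.adicCompletionIntegers K) := by
    have hsplit : y₀ - algebraMap (𝓞 K) _ (n : 𝓞 K) =
        (y₀ - algebraMap (𝓞 K) _ c) + algebraMap (𝓞 K) _ (c - n) := by
      rw [map_sub]; abel
    rw [hsplit]
    refine Ideal.add_mem _ hc ?_
    rw [← IsLocalRing.residue_eq_zero_iff, HeightOneSpectrum.residue_algebraMap_eq_zero_iff]
    exact hcn
  rw [IsLocalRing.mem_maximalIdeal, mem_nonunits_iff,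
    HeightOneSpectrum.adicCompletionIntegers.isUnit_iff_valued_eq_one] at hmem
  have hle : Valued.v ((y₀ - algebraMap (𝓞 K) _ (n : 𝓞 K) : v.adicCompletionIntegers K) :
      v.adicCompletion K) ≤ 1 := (y₀ - _).2
  have heq : ((y₀ - algebraMap (𝓞 K) _ (n : 𝓞 K) : v.adicCompletionIntegers K) :
      v.adicCompletion K) = y - n := by
    rw [map_intCast]
    push_cast
    rw [hy₀]
  rw [heq] at hmem hle
  exact lt_of_le_of_ne hle hmem

/-- **`p` splits completely at `v` ⇒ `ℚ_p → K_v` is onto.** For a number field `K`, a prime `p`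
and a place `v ∣ p` with residue degree `1` (`N v = p`) and ramification index `1`
(`v² ∤ (p)`), the canonical embedding `ℚ_p → K_v` (tree `LocalField.adicCompletionPadicAlgebra`)
is surjective: `K_v = ℚ_p` (Neukirch, ANT II (5.2), (8.2): `[K_v : ℚ_p] = e_v f_v = 1`).
[folklore] -/
theorem algebraMap_adicCompletion_surjective_of_split (hv : ((p : ℕ) : 𝓞 K) ∈ v.asIdeal)
    (hf : v.residueCard = p) (he : ¬ v.asIdeal ^ 2 ∣ Ideal.span {((p : ℕ) : 𝓞 K)}) :
    letI := LocalField.adicCompletionPadicAlgebra v p hv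
    Function.Surjective (algebraMap ℚ_[p] (v.adicCompletion K)) := by
  haveI := LocalField.charZero_adicCompletion v
  exact padicRingHom_surjective_of_uniformizer_of_residue
    (LocalField.valuation_adicCompletion_natCast_lt_one v p hv)
    (fun x hx => valuation_le_valuation_natCast_of_lt_one v p hv he x hx)
    (fun y hy => exists_int_valuation_sub_lt_one v p hf y hy)

/-- **`p` splits completely at `v` ⇒ `ℚ_p ≅ K_v`** (the canonical embedding is bijective).
[folklore] -/
theorem algebraMap_adicCompletion_bijective_of_split (hv : ((p : ℕ) : 𝓞 K) ∈ v.asIdeal)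
    (hf : v.residueCard = p) (he : ¬ v.asIdeal ^ 2 ∣ Ideal.span {((p : ℕ) : 𝓞 K)}) :
    letI := LocalField.adicCompletionPadicAlgebra v p hv
    Function.Bijective (algebraMap ℚ_[p] (v.adicCompletion K)) := by
  letI := LocalField.adicCompletionPadicAlgebra v p hv
  exact ⟨(algebraMap ℚ_[p] (v.adicCompletion K)).injective,
    algebraMap_adicCompletion_surjective_of_split v p hv hf he⟩

/-- **`p` splits completely at `v` ⇒ `[K_v : ℚ_p] = 1`** (for the canonical `ℚ_p`-structure).
[folklore] -/
theorem finrank_adicCompletion_eq_one_of_split (hv : ((p : ℕ) : 𝓞 K) ∈ v.asIdeal)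
    (hf : v.residueCard = p) (he : ¬ v.asIdeal ^ 2 ∣ Ideal.span {((p : ℕ) : 𝓞 K)}) :
    letI := LocalField.adicCompletionPadicAlgebra v p hv
    Module.finrank ℚ_[p] (v.adicCompletion K) = 1 := by
  letI := LocalField.adicCompletionPadicAlgebra v p hv
  have e := AlgEquiv.ofBijective (Algebra.ofId ℚ_[p] (v.adicCompletion K))
    (algebraMap_adicCompletion_bijective_of_split v p hv hf he)
  rw [← e.toLinearEquiv.finrank_eq, Module.finrank_self]

/-- **`p` splits completely at `v` ⇒ `K_v` has at most one `ℚ_p`-embedding into any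
`ℚ_p`-algebra** (two `ℚ_p`-algebra maps agree on the image of `ℚ_p`, which is everything).
[folklore] -/
theorem algHom_adicCompletion_subsingleton_of_split (hv : ((p : ℕ) : 𝓞 K) ∈ v.asIdeal)
    (hf : v.residueCard = p) (he : ¬ v.asIdeal ^ 2 ∣ Ideal.span {((p : ℕ) : 𝓞 K)})
    (A : Type*) [Semiring A] [Algebra ℚ_[p] A] :
    letI := LocalField.adicCompletionPadicAlgebra v p hv
    Subsingleton (v.adicCompletion K →ₐ[ℚ_[p]] A) := by
  letI := LocalField.adicCompletionPadicAlgebra v p hv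
  refine ⟨fun f g => AlgHom.ext fun x => ?_⟩
  obtain ⟨q, rfl⟩ := algebraMap_adicCompletion_surjective_of_split v p hv hf he x
  rw [AlgHom.commutes, AlgHom.commutes]

/-- **`p` splits completely at `v` ⇒ `K_v` has a `ℚ_p`-embedding into every `ℚ_p`-algebra**
(the inverse of `ℚ_p ≅ K_v` followed by the structure map). [folklore] -/
theorem algHom_adicCompletion_nonempty_of_split (hv : ((p : ℕ) : 𝓞 K) ∈ v.asIdeal)
    (hf : v.residueCard = p) (he : ¬ v.asIdeal ^ 2 ∣ Ideal.span {((p : ℕ) : 𝓞 K)})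
    (A : Type*) [Semiring A] [Algebra ℚ_[p] A] :
    letI := LocalField.adicCompletionPadicAlgebra v p hv
    Nonempty (v.adicCompletion K →ₐ[ℚ_[p]] A) := by
  letI := LocalField.adicCompletionPadicAlgebra v p hv
  have e := AlgEquiv.ofBijective (Algebra.ofId ℚ_[p] (v.adicCompletion K))
    (algebraMap_adicCompletion_bijective_of_split v p hv hf he)
  exact ⟨(Algebra.ofId ℚ_[p] A).comp e.symm.toAlgHom⟩

end AdicCompletion

/-! ### The item's datum in the split case -/

/-- **The split-completely hypothesis of `LiftB2CrysSplitP`, unpacked at the item's datum.**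
Under Fontaine's existence theorem `FontaineDatumExists` (so that the pinned datum
`D = RD.pst p v hv = fontainePstAdicCompletion v p hv` carries the CANONICAL `ℚ_p`-structure of
`F_v`, clause (F1)), if `p` splits completely in `F` in the exact form of the item's hypothesis,
then for every reciprocity datum `RD` and every `v ∣ p`: the structure map `ℚ_p → F_v` of
`D.algebra` is a bijection (`F_v = ℚ_p`, Kisin's setting), and the embeddings
`τ : F_v →ₐ[ℚ_p] ℚ̄_p` over which the item quantifies its labelled Hodge–Tate weights exist and
are unique. [folklore] -/
theorem splitP_pst_algebraMap_bijective
    (hFD : Literature.NumberTheory.PAdicHodge.FontaineDatumExists)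
    (F : Type) [Field F] [NumberField F] (p : ℕ) [Fact p.Prime]
    (hsplit : ∀ v : HeightOneSpectrum (𝓞 F), ((p : ℕ) : 𝓞 F) ∈ v.asIdeal →
      v.residueCard = p ∧ ¬ v.asIdeal ^ 2 ∣ Ideal.span {((p : ℕ) : 𝓞 F)})
    (RD : ReciprocityData F) (v : HeightOneSpectrum (𝓞 F)) (hv : ((p : ℕ) : 𝓞 F) ∈ v.asIdeal) :
    let D := RD.pst p v hv
    Function.Bijective (@algebraMap ℚ_[p] (v.adicCompletion F) _ _ D.algebra) ∧
      (letI := D.algebra; Subsingleton (v.adicCompletion F →ₐ[ℚ_[p]] PadicAlgCl p)) ∧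
      (letI := D.algebra; Nonempty (v.adicCompletion F →ₐ[ℚ_[p]] PadicAlgCl p)) := by
  intro D
  have hD : D.algebra = LocalField.adicCompletionPadicAlgebra v p hv :=
    Literature.NumberTheory.PAdicHodge.fontainePstAdicCompletion_algebra hFD v p hv
  rw [hD]
  exact ⟨algebraMap_adicCompletion_bijective_of_split v p hv (hsplit v hv).1 (hsplit v hv).2,
    algHom_adicCompletion_subsingleton_of_split v p hv (hsplit v hv).1 (hsplit v hv).2 _,
    algHom_adicCompletion_nonempty_of_split v p hv (hsplit v hv).1 (hsplit v hv).2 _⟩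

end Summit.Langlands.Langlands.Theorems.LiftB2CrysSplitP

end
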